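import Mathlib
import Summits.NavierStokesRegularity.NavierStokesRegularity.Theorems.OrthantWakeDyadicBreakBelowOneOfShellBarrier
import Summits.NavierStokesRegularity.NavierStokesRegularity.Theorems.SubOnsagerCeilingGapChain10
import Summits.NavierStokesRegularity.NavierStokesRegularity.Theorems.SubOnsagerCeilingDyadicTailCeilingScaling
import HarnessLib

/-!
# `OrthantWake.DyadicBreakBelowOne` on `[9/25, 1]` and from `SubOnsagerCeiling.DyadicTailCeiling`:
# no Theorem-4.2 blow-up for the dyadic member at every shell ratio `1 + ε₀ ∈ [34/25, 2]`

Item stmt-NavierStokesRegularity-24644 (`OrthantWake.DyadicBreakBelowOne`, aside «open in print»: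
`∀ ε₀ ∈ (0,1), ∀ X₀, ¬ NoGlobalCascade ε₀ dyadicTable X₀`).  The tree recorded it down to `ε₀ ≥ 9/16`
(`dyadicBreakBelowOne_of_ge_nine_sixteenths`); meanwhile the LEAD of route SubOnsagerCeiling certified the
ν-uniform chain barrier down to `b = 34/25` (`dyadicGapRange10Wide_shellBarrierAt`: `θ = 101/200`, `D = 100`,
every scaled dyadic table, every `ε₀ ∈ [9/25, 1]` — Ω-coupled four-window kernel certificates and the 13-face
spec-list designs).  This file (`--supports`) is the one-line consumer through the interval-free adapter
`dyadicBreakBelowOne_on_of_shellBarrierAt`, and it also records the BY-NAME implication from the sibling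
route's one-mode item `SubOnsagerCeiling.DyadicTailCeiling` (stmt-25511) through the amplitude-scaling bridge
`shellBarrierAt_scaledDyadic_of_dyadicTailCeilingAt` (p834216):

* `not_noGlobalCascade_dyadicTable_of_ge_nine_twentyfifths` — for every `ε₀ ∈ [9/25, 1]` and every one-shell
  datum, `¬ NoGlobalCascade ε₀ dyadicTable X₀`; `dyadicBreakBelowOne_of_ge_nine_twentyfifths` — the item's
  shape on `[9/25, 1)` (supersedes `[9/16, 1)`);
* `not_noGlobalCascade_dyadicTable_of_dyadicTailCeilingAt` — the body of `DyadicTailCeiling` at ONE ratio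
  `ε₀ > 0` gives `¬ NoGlobalCascade ε₀ dyadicTable X₀` for every datum;
* `dyadicBreakBelowOne_of_dyadicTailCeiling` — `DyadicTailCeiling → (∀ ε₀ ∈ (0,1], ∀ X₀, ¬ NoGlobalCascade …)`,
  in particular item 24644's statement;
* `dyadicBreakBelowOne_of_smallRatio` — what is left of item 24644: its small-ratio part `ε₀ ∈ (0, 9/25)`.

HONEST FRAMING: theorems about a MODEL lattice ODE (routes OrthantWake / SubOnsagerCeiling, rung TL-M2Break);
corollaries of landed theorems and reductions between open statements; item 24644 (all of `(0,1)`) is NOT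
closed (its part `ε₀ < 9/25` is ≥ open in print: BMR's region is certified at ratio 2 only); no crux, rung
target or summit is proved; nothing here is a statement about the Navier–Stokes equations.
[cite: BarbatoMorandinRomito2011, Thm. 1, §2 Lemma 2.1] [cite: Tao2016AveragedNS, §4 Thm. 4.2]
-/

noncomputable section

-- the sub-problem namespace `NavierStokesRegularity.NavierStokesRegularity` is the tree's layout (D-0017)
set_option linter.dupNamespace false

namespace Summit.NavierStokesRegularity.NavierStokesRegularity.Theorems

open Set
open Literature.Analysis.FluidPDE.TaoCascade
open Summit.NavierStokesRegularity.NavierStokesRegularity.Theses.SubOnsagerCeiling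
open Summit.NavierStokesRegularity.NavierStokesRegularity.Theorems.SubOnsagerCeiling

/-- **`DyadicBreakBelowOne` on `[9/25, 1]`**: for every shell ratio `1+ε₀ ∈ [34/25, 2]` and every one-shell
datum `X₀`, Theorem 4.2-level blow-up fails for the dyadic member: `¬ NoGlobalCascade ε₀ dyadicTable X₀` — the
certified shell-barrier range `dyadicGapRange10Wide_shellBarrierAt` (`θ = 101/200 > 1/2`, uniformly in `ν`)
through `dyadicBreakBelowOne_on_of_shellBarrierAt`. MODEL lattice statement; `ε₀ < 9/25` remains open.
[this file] -/
theorem not_noGlobalCascade_dyadicTable_of_ge_nine_twentyfifths {ε₀ : ℝ} (h₁ : 9 / 25 ≤ ε₀)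
    (h₂ : ε₀ ≤ 1) (X₀ : Fin 4 → ℝ) : ¬ NoGlobalCascade ε₀ dyadicTable X₀ :=
  dyadicBreakBelowOne_on_of_shellBarrierAt (by norm_num) dyadicGapRange10Wide_shellBarrierAt ε₀ h₁ h₂ X₀

/-- The item's shape on the certified range: `∀ ε₀ ∈ [9/25, 1), ∀ X₀, ¬ NoGlobalCascade ε₀ dyadicTable X₀`
(supersedes `dyadicBreakBelowOne_of_ge_nine_sixteenths`). MODEL lattice statement. [this file] -/
theorem dyadicBreakBelowOne_of_ge_nine_twentyfifths :
    ∀ ε₀ : ℝ, 9 / 25 ≤ ε₀ → ε₀ < 1 → ∀ X₀ : Fin 4 → ℝ, ¬ NoGlobalCascade ε₀ dyadicTable X₀ :=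
  fun _ h₁ h₂ X₀ => not_noGlobalCascade_dyadicTable_of_ge_nine_twentyfifths h₁ h₂.le X₀

/-- **One ratio of `DyadicTailCeiling` ⇒ no Theorem-4.2 blow-up for the dyadic member at that ratio.**  The body
of the route item `SubOnsagerCeiling.DyadicTailCeiling` (stmt-25511) at `ε₀ > 0` gives, through the amplitude
scaling bridge `shellBarrierAt_scaledDyadic_of_dyadicTailCeilingAt` (spread `R = 2`) and the socket
`not_noGlobalCascade_dyadicTable_of_isScaledDyadic_shellBarrierAt`, `¬ NoGlobalCascade ε₀ dyadicTable X₀` for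
every one-shell datum. Conditional on an open statement; MODEL lattice only. [this file] -/
theorem not_noGlobalCascade_dyadicTable_of_dyadicTailCeilingAt {ε₀ : ℝ} (hε : 0 < ε₀)
    (h : ∃ θ : ℝ, 1 / 2 < θ ∧ ∃ C : ℝ, 0 ≤ C ∧ ∀ ν : ℝ, 0 < ν → ∀ (X₀ : Fin 4 → ℝ) (s : ℝ), 0 < s →
      ∀ X : Fin 4 → ℤ → ℝ → ℝ, (∀ (i : Fin 4) (k : ℤ), X i k 0 = if k = 0 then X₀ i else 0) →
      (∀ (i : Fin 4) (k : ℤ), k < 0 → ∀ t : ℝ, X i k t = 0) →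
      (∃ M : ℝ, ∀ (t : ℝ) (i : Fin 4) (k : ℤ), (1 + (1 + ε₀) ^ ((10 : ℝ) * k)) * |X i k t| ≤ M) →
      (∀ (i : Fin 4) (k : ℤ), Continuous (X i k)) →
      (∀ (i : Fin 4) (k : ℤ), ∀ t ∈ Set.Icc (0 : ℝ) s, HasDerivWithinAt (X i k)
        (Literature.Analysis.FluidPDE.TaoCascade.quadTerm ε₀ Literature.Analysis.FluidPDE.TaoCascade.dyadicTable X i k t
          - ν * (1 + ε₀) ^ ((2 : ℝ) * k) * X i k t) (Set.Icc (0 : ℝ) s) t) →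
      (∀ t ∈ Set.Icc (0 : ℝ) s, ∀ (i : Fin 4) (k : ℤ), 1 ≤ k → 0 ≤ X i k t) →
      ∀ n N : ℕ, n ≤ N → ∀ t ∈ Set.Icc (0 : ℝ) s,
        ∑ k ∈ Finset.Icc n N, ∑ i : Fin 4, (1 / 2 : ℝ) * X i (k : ℤ) t ^ 2 ≤
          C * (∑ i : Fin 4, (1 / 2 : ℝ) * X₀ i ^ 2) * (1 + ε₀) ^ (-(2 * θ * (n : ℝ))))
    (X₀ : Fin 4 → ℝ) : ¬ NoGlobalCascade ε₀ dyadicTable X₀ :=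
  not_noGlobalCascade_dyadicTable_of_isScaledDyadic_shellBarrierAt le_rfl hε
    (shellBarrierAt_scaledDyadic_of_dyadicTailCeilingAt hε h 2) X₀

/-- **`DyadicTailCeiling` (stmt-25511, route SubOnsagerCeiling) ⇒ `DyadicBreakBelowOne` (stmt-24644, route
OrthantWake)**, indeed `¬ NoGlobalCascade ε₀ dyadicTable X₀` at every `ε₀ ∈ (0, 1]` (the item's own range is
`ε₀ < 1`). A reduction between open statements; MODEL lattice only. [this file] -/
theorem dyadicBreakBelowOne_of_dyadicTailCeiling (h : DyadicTailCeiling) :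
    ∀ ε₀ : ℝ, 0 < ε₀ → ε₀ ≤ 1 → ∀ X₀ : Fin 4 → ℝ, ¬ NoGlobalCascade ε₀ dyadicTable X₀ :=
  fun ε₀ h0 hle X₀ => not_noGlobalCascade_dyadicTable_of_dyadicTailCeilingAt h0 (h ε₀ h0 hle) X₀

/-- **What is left of item stmt-24644, by name: `DyadicBreakBelowOne` follows from its SMALL-RATIO part.**  If
`¬ NoGlobalCascade ε₀ dyadicTable X₀` holds for every `ε₀ ∈ (0, 9/25)` (shell ratios `b ∈ (1, 1.36)`) and every
datum, then it holds at every `ε₀ ∈ (0, 1)`, the range `[9/25, 1)` being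
`dyadicBreakBelowOne_of_ge_nine_twentyfifths`. A reduction between statements; MODEL lattice only. [this file] -/
theorem dyadicBreakBelowOne_of_smallRatio
    (h : ∀ ε₀ : ℝ, 0 < ε₀ → ε₀ < 9 / 25 → ∀ X₀ : Fin 4 → ℝ, ¬ NoGlobalCascade ε₀ dyadicTable X₀) :
    ∀ ε₀ : ℝ, 0 < ε₀ → ε₀ < 1 → ∀ X₀ : Fin 4 → ℝ, ¬ NoGlobalCascade ε₀ dyadicTable X₀ := by
  intro ε₀ h0 h1 X₀
  rcases lt_or_ge ε₀ (9 / 25) with hlt | hge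
  · exact h ε₀ h0 hlt X₀
  · exact dyadicBreakBelowOne_of_ge_nine_twentyfifths ε₀ hge h1 X₀

end Summit.NavierStokesRegularity.NavierStokesRegularity.Theorems

end
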